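import Summits.Ventures.Crystal3D.Theorems.StickyWulffConstantGenericWallFloorDoubleTopLocalCert
import HarnessLib

/-!
# Double tops, local part 3: soundness of the rational rigidity certificates
# (crux `GenericWallFloor`, line `WallLedgerG`, residual `#DT₁₁`; local half of R39d «DoubleStarFree»)

HONEST FRAMING. Part of the venture `Summits/Ventures/Crystal3D` (cell `crystal3d-full`), helper
`--supports` the crux `GenericWallFloor` (stmt-Ventures-19480) of `route-Ventures-StickyWulffConstant`,
registered line `WallLedgerG`, open stub `stub_twoSlabAdhesion`.  Continues `…DoubleTopLocalCore` (the
four constraint families with exact quadratic remainders) and `…DoubleTopLocalCert` (the certificate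
format `DTCert`, its decidable validity predicate, the real semantics `fR`, `qR`, `y0R`).

**`DTCert.sound`.**  If `C.valid`, then for every `κ` with `1 + κ` orthogonal and every `y`: the fixed
cluster `F̂` and the moving cluster `(1+κ)·Q` `1`-separated up to coincidence
(`F̂ i = (1+κ)Q j ∨ |F̂ i − (1+κ)Q j|² ≥ 2`, lengths × `√2`), `|y|² = 2` and `y` at squared distance `≥ 2`
from the `24` non-centre balls (when `C.useY`), and `‖κ‖_F² + |y − y₀|² < 1/C.Ktot` ⇒ `κ = 0`.
So inside that explicit ball around the reference (co-axial) configuration, the only double top carrying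
an eleventh neighbour is the co-axial configuration itself — the LOCAL half of DoubleTopDegree; the
complement is interval territory (positive margin, R39d).

Proof: `boundJ/C/F/M/S` bound each weighted form by `c·U` (`U = ‖κ‖_F² + |η|²`, `η = y − y₀`) using
part 1; `target_le` regroups the certificate identity `Σ λ·form = ±a_l / ±η_l` (`sumA = tvA`,
`sumE = tvE`, cast to `ℝ`) to get `|a_l|, |η_l| ≤ K·U`; `frob_le_axis_sq` gives `‖κ‖_F² ≤ (8/3)|a|²`,
whence `U ≤ Ktot·U²` and `U = 0` (`eq_zero_of_le_mul_sq`).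

WHAT THIS IS NOT: the certificates (data files `…DoubleTopLocalData*`), the packaging to
`A₁, A₂, fccSlots` and the co-axiality conclusion, the global half; rung F-C1 not moved.
-/
noncomputable section

namespace Summit.Ventures.Crystal3D.Theorems.NearIdentity

open Matrix
/-! ### Soundness: the form bounds -/

section Forms

variable (C : DTCert) (κ : Matrix (Fin 3) (Fin 3) ℝ) (y : Fin 3 → ℝ)

/-- `|Q j|² ≤ 8` in real form. -/
theorem DTCert.qR_sq_le (hQ8 : ∀ j, dotQ (C.Q j) (C.Q j) ≤ 8) (j : Fin 13) : C.qR j ⬝ᵥ C.qR j ≤ 8 := by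
  have h : ((dotQ (C.Q j) (C.Q j) : ℚ) : ℝ) ≤ 8 := by exact_mod_cast hQ8 j
  rwa [cast_dotQ] at h

/-- Contact forms: `a ⬝ (Q j × F̂ i) ≤ cJ · ‖κ‖_F²`. -/
theorem DTCert.boundJ (horth : ∀ i j, κ i j + κ j i + ∑ l, κ l i * κ l j = 0) (hJ : C.validJ) (hQ8 : ∀ j, dotQ (C.Q j) (C.Q j) ≤ 8) (hFb : frob κ < 1 / 4)
    (hclus : ∀ i j, fR i = C.qR j + κ *ᵥ C.qR j ∨
      2 ≤ (fR i - (C.qR j + κ *ᵥ C.qR j)) ⬝ᵥ (fR i - (C.qR j + κ *ᵥ C.qR j)))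
    {s w : Bool} {l : Fin 3} {i j : Fin 13} (hne : C.lamJ s w l i j ≠ 0) :
    axisOf κ ⬝ᵥ crossProduct (C.qR j) (fR i) ≤ (C.cJ i j : ℝ) * frob κ := by
  obtain ⟨-, hd⟩ := hJ s w l i j hne
  have hdR : (fR i - C.qR j) ⬝ᵥ (fR i - C.qR j) = 2 := by
    have e := cast_dotQ (clusterQ i - C.Q j) (clusterQ i - C.Q j)
    rw [hd, castVec_sub] at e; push_cast at e
    exact e.symm
  have hq := C.qR_sq_le hQ8 j
  have hne' : fR i ≠ C.qR j + κ *ᵥ C.qR j := by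
    apply ne_add_mulVec_of_lt
    rw [hdR]
    nlinarith [hq, (by rw [dot_self_eq_sum_sq]; exact Finset.sum_nonneg fun _ _ => sq_nonneg _ : (0:ℝ) ≤ (C.qR j) ⬝ᵥ (C.qR j)), frob_nonneg κ]
  have hge : (fR i - C.qR j) ⬝ᵥ (fR i - C.qR j) ≤
      (fR i - (C.qR j + κ *ᵥ C.qR j)) ⬝ᵥ (fR i - (C.qR j + κ *ᵥ C.qR j)) := by
    rw [hdR]; exact (hclus i j).resolve_left hne'
  have h1 := axis_dot_cross_le_of_contact κ horth (fR i) (C.qR j) hge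
  have hc : (C.cJ i j : ℝ) = (fR i ⬝ᵥ fR i + C.qR j ⬝ᵥ C.qR j) / 4 := by
    simp only [DTCert.cJ]; push_cast; rw [cast_dotQ, cast_dotQ]; rfl
  rw [hc]
  linarith

/-- Coincidence forms vanish. -/
theorem DTCert.boundC (horth : ∀ i j, κ i j + κ j i + ∑ l, κ l i * κ l j = 0) (hCo : C.validC) (hQ8 : ∀ j, dotQ (C.Q j) (C.Q j) ≤ 8) (hFb : frob κ < 1 / 4)
    (hclus : ∀ i j, fR i = C.qR j + κ *ᵥ C.qR j ∨
      2 ≤ (fR i - (C.qR j + κ *ᵥ C.qR j)) ⬝ᵥ (fR i - (C.qR j + κ *ᵥ C.qR j)))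
    {s w : Bool} {l : Fin 3} {j : Fin 13} {m : Fin 3} (hne : C.lamC s w l j m ≠ 0) :
    axisOf κ ⬝ᵥ crossProduct (C.qR j) (Pi.single m 1) = 0 := by
  obtain ⟨i, hi⟩ := hCo s w l j m hne
  have hiR : fR i = C.qR j := by rw [fR, hi]; rfl
  have hq := C.qR_sq_le hQ8 j
  have hfix : κ *ᵥ C.qR j = 0 := by
    rcases hclus i j with h | h
    · rw [hiR] at h
      have := congrArg (fun v => v - C.qR j) h
      simpa using this.symm
    · exfalso
      rw [hiR, show C.qR j - (C.qR j + κ *ᵥ C.qR j) = -(κ *ᵥ C.qR j) by abel] at h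
      have h' : 2 ≤ (κ *ᵥ C.qR j) ⬝ᵥ (κ *ᵥ C.qR j) := by simpa using h
      have := mulVec_sq_le' κ (C.qR j)
      nlinarith [hq, (by rw [dot_self_eq_sum_sq]; exact Finset.sum_nonneg fun _ _ => sq_nonneg _ : (0:ℝ) ≤ (C.qR j) ⬝ᵥ (C.qR j)), frob_nonneg κ]
  exact axis_dot_cross_eq_zero_of_fixed κ horth _ _ hfix

/-- Fixed cage forms: `(F̂ i − y₀) ⬝ η ≤ |η|²/2`. -/
theorem DTCert.boundF (hF : C.validF)
    (hcF : C.useY = true → ∀ i, clusterQ i ≠ 0 → 2 ≤ (y - fR i) ⬝ᵥ (y - fR i))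
    {s w : Bool} {l : Fin 3} {i : Fin 13} (hne : C.lamF s w l i ≠ 0) :
    (fR i - C.y0R) ⬝ᵥ (y - C.y0R) ≤ (y - C.y0R) ⬝ᵥ (y - C.y0R) / 2 := by
  obtain ⟨-, huse, hi0, hd⟩ := hF s w l i hne
  have hdR : (C.y0R - fR i) ⬝ᵥ (C.y0R - fR i) = 2 := by
    have e := cast_dotQ (C.y0 - clusterQ i) (C.y0 - clusterQ i)
    rw [hd, castVec_sub] at e; push_cast at e
    exact e.symm
  have h2 := hcF huse i hi0
  have hge : (C.y0R - fR i) ⬝ᵥ (C.y0R - fR i) ≤ (C.y0R + (y - C.y0R) - fR i) ⬝ᵥ (C.y0R + (y - C.y0R) - fR i) := by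
    rw [hdR, add_sub_cancel]; exact h2
  exact cage_fixed_le (fR i) C.y0R (y - C.y0R) hge

/-- Moving cage forms: `(Q j − y₀) ⬝ η + a ⬝ (Q j × y₀) ≤ |η|² + cM' ‖κ‖_F² ≤ cM (‖κ‖_F² + |η|²)`. -/
theorem DTCert.boundM (horth : ∀ i j, κ i j + κ j i + ∑ l, κ l i * κ l j = 0) (hM : C.validM) (hy0 : C.useY = true → dotQ C.y0 C.y0 = 2)
    (hcM : C.useY = true → ∀ j, C.Q j ≠ 0 → 2 ≤ (y - (C.qR j + κ *ᵥ C.qR j)) ⬝ᵥ (y - (C.qR j + κ *ᵥ C.qR j)))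
    {s w : Bool} {l : Fin 3} {j : Fin 13} (hne : C.lamM s w l j ≠ 0) :
    (C.qR j - C.y0R) ⬝ᵥ (y - C.y0R) + axisOf κ ⬝ᵥ crossProduct (C.qR j) C.y0R ≤
      (C.cM j : ℝ) * (frob κ + (y - C.y0R) ⬝ᵥ (y - C.y0R)) := by
  obtain ⟨-, huse, hj0, hd⟩ := hM s w l j hne
  set η := y - C.y0R with hη
  have hdR : (C.y0R - C.qR j) ⬝ᵥ (C.y0R - C.qR j) = 2 := by
    have e := cast_dotQ (C.y0 - C.Q j) (C.y0 - C.Q j)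
    rw [hd, castVec_sub] at e; push_cast at e
    exact e.symm
  have h2 := hcM huse j hj0
  have hge : (C.y0R - C.qR j) ⬝ᵥ (C.y0R - C.qR j) ≤
      (C.y0R + η - (C.qR j + κ *ᵥ C.qR j)) ⬝ᵥ (C.y0R + η - (C.qR j + κ *ᵥ C.qR j)) := by
    rw [hdR, hη, add_sub_cancel]; exact h2
  have h1 := cage_moving_le κ horth (C.qR j) C.y0R η hge
  have hy0R : C.y0R ⬝ᵥ C.y0R = 2 := by
    have e := cast_dotQ C.y0 C.y0; rw [hy0 huse] at e; push_cast at e; exact e.symm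
  have hcM1 : (1 : ℝ) ≤ (C.cM j : ℝ) := by
    have := le_max_left (1 : ℚ) ((3 * dotQ (C.Q j) (C.Q j) + dotQ C.y0 C.y0) / 4)
    exact_mod_cast this
  have hcM2 : (3 * (C.qR j ⬝ᵥ C.qR j) + C.y0R ⬝ᵥ C.y0R) / 4 ≤ (C.cM j : ℝ) := by
    have := le_max_right (1 : ℚ) ((3 * dotQ (C.Q j) (C.Q j) + dotQ C.y0 C.y0) / 4)
    have h' : (((3 * dotQ (C.Q j) (C.Q j) + dotQ C.y0 C.y0) / 4 : ℚ) : ℝ) ≤ (C.cM j : ℝ) := by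
      exact_mod_cast this
    push_cast at h'; rw [cast_dotQ, cast_dotQ] at h'; exact h'
  have hFb0 := frob_nonneg κ
  have hE0 := (by rw [dot_self_eq_sum_sq]; exact Finset.sum_nonneg fun _ _ => sq_nonneg _ : (0:ℝ) ≤ η ⬝ᵥ η)
  have step1 : frob κ * (3 * (C.qR j ⬝ᵥ C.qR j) + C.y0R ⬝ᵥ C.y0R) / 4 ≤ frob κ * (C.cM j : ℝ) := by
    have := mul_le_mul_of_nonneg_left hcM2 hFb0
    linarith
  have step2 : η ⬝ᵥ η ≤ η ⬝ᵥ η * (C.cM j : ℝ) := by nlinarith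
  calc (C.qR j - C.y0R) ⬝ᵥ η + axisOf κ ⬝ᵥ crossProduct (C.qR j) C.y0R
      ≤ η ⬝ᵥ η + frob κ * (3 * (C.qR j ⬝ᵥ C.qR j) + C.y0R ⬝ᵥ C.y0R) / 4 := h1
    _ ≤ η ⬝ᵥ η * (C.cM j : ℝ) + frob κ * (C.cM j : ℝ) := by linarith
    _ = (C.cM j : ℝ) * (frob κ + η ⬝ᵥ η) := by ring

/-- Sphere: `y₀ ⬝ η = −|η|²/2` whenever a sphere multiplier is used. -/
theorem DTCert.boundS (hS : C.validS) (hy0 : C.useY = true → dotQ C.y0 C.y0 = 2)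
    (hy : C.useY = true → y ⬝ᵥ y = 2) {s w : Bool} {l : Fin 3}
    (hne : C.lamSp s w l ≠ 0 ∨ C.lamSm s w l ≠ 0) :
    C.y0R ⬝ᵥ (y - C.y0R) = -((y - C.y0R) ⬝ᵥ (y - C.y0R)) / 2 := by
  have huse := (hS s w l).2.2 hne
  have hy0R : C.y0R ⬝ᵥ C.y0R = 2 := by
    have e := cast_dotQ C.y0 C.y0; rw [hy0 huse] at e; push_cast at e; exact e.symm
  exact dot_eq_of_sphere C.y0R (y - C.y0R) (by rw [add_sub_cancel, hy huse, hy0R])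

end Forms

/-! ### Soundness: the targets and the squeeze -/

namespace DTCert

variable (C : DTCert)

/-- The per-target inequality `sgn(s)·x_{w,l} ≤ K(s,w,l)·U`. -/
theorem target_le (hC : C.valid) (κ : Matrix (Fin 3) (Fin 3) ℝ)
    (horth : ∀ i j, κ i j + κ j i + ∑ l, κ l i * κ l j = 0) (y : Fin 3 → ℝ)
    (hclus : ∀ i j, fR i = C.qR j + κ *ᵥ C.qR j ∨
      2 ≤ (fR i - (C.qR j + κ *ᵥ C.qR j)) ⬝ᵥ (fR i - (C.qR j + κ *ᵥ C.qR j)))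
    (hy : C.useY = true → y ⬝ᵥ y = 2)
    (hcF : C.useY = true → ∀ i, clusterQ i ≠ 0 → 2 ≤ (y - fR i) ⬝ᵥ (y - fR i))
    (hcM : C.useY = true → ∀ j, C.Q j ≠ 0 → 2 ≤ (y - (C.qR j + κ *ᵥ C.qR j)) ⬝ᵥ (y - (C.qR j + κ *ᵥ C.qR j)))
    (hFb : frob κ < 1 / 4) (s w : Bool) (l : Fin 3) (hrel : w = false ∨ C.useY = true) :
    ((sgnQ s : ℚ) : ℝ) * (if w then (y - C.y0R) l else axisOf κ l) ≤
      (C.K s w l : ℝ) * (frob κ + (if C.useY then (y - C.y0R) ⬝ᵥ (y - C.y0R) else 0)) := by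
  obtain ⟨⟨hQ8, hy0, -, -⟩, hJ, hCo, hF, hM, hS, hId, -⟩ := hC
  obtain ⟨hA, hEid⟩ := hId s w l hrel
  set a := axisOf κ with ha
  set η : Fin 3 → ℝ := y - C.y0R with hη
  set Fb := frob κ with hFb'
  set E : ℝ := if C.useY then η ⬝ᵥ η else 0 with hE
  set U : ℝ := Fb + E with hU
  have hFb0 : 0 ≤ Fb := frob_nonneg κ
  have hE0 : 0 ≤ E := by rw [hE]; split_ifs; exacts [(by rw [dot_self_eq_sum_sq]; exact Finset.sum_nonneg fun _ _ => sq_nonneg _ : (0:ℝ) ≤ η ⬝ᵥ η), le_rfl]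
  have hU0 : 0 ≤ U := add_nonneg hFb0 hE0
  have hFbU : Fb ≤ U := by linarith
  have hEU : E ≤ U := by linarith
  have hqR : ∀ j, C.qR j = castVec (C.Q j) := fun j => rfl
  have hy0R' : C.y0R = castVec C.y0 := rfl
  -- the five groups of weighted forms
  set T1 : ℝ := ∑ i, ∑ j, (C.lamJ s w l i j : ℝ) * (a ⬝ᵥ crossProduct (C.qR j) (fR i)) with hT1
  set T2 : ℝ := ∑ j, ∑ m, (C.lamC s w l j m : ℝ) * (a ⬝ᵥ crossProduct (C.qR j) (Pi.single m 1)) with hT2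
  set T3 : ℝ := ∑ j, (C.lamM s w l j : ℝ) * ((C.qR j - C.y0R) ⬝ᵥ η + a ⬝ᵥ crossProduct (C.qR j) C.y0R) with hT3
  set T4 : ℝ := ∑ i, (C.lamF s w l i : ℝ) * ((fR i - C.y0R) ⬝ᵥ η) with hT4
  set T5 : ℝ := ((C.lamSp s w l : ℝ) - C.lamSm s w l) * (C.y0R ⬝ᵥ η) with hT5
  -- (a) regrouped by coordinates they give the target value
  have eA : ∀ l', ((tvA s w l l' : ℚ) : ℝ) =
      (∑ i, ∑ j, (C.lamJ s w l i j : ℝ) * crossProduct (C.qR j) (fR i) l') +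
      (∑ j, ∑ m, (C.lamC s w l j m : ℝ) * crossProduct (C.qR j) (Pi.single m (1 : ℝ)) l') +
      ∑ j, (C.lamM s w l j : ℝ) * crossProduct (C.qR j) C.y0R l' := by
    intro l'
    rw [← hA l', sumA]; push_cast
    simp only [cast_crossQ, castVec_basisQ, hqR, hy0R', fR]
  have eE : ∀ l', ((tvE s w l l' : ℚ) : ℝ) =
      (∑ i, (C.lamF s w l i : ℝ) * (fR i - C.y0R) l') + (∑ j, (C.lamM s w l j : ℝ) * (C.qR j - C.y0R) l') +
      ((C.lamSp s w l : ℝ) - C.lamSm s w l) * C.y0R l' := by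
    intro l'
    rw [← hEid l', sumE]; push_cast
    simp only [hqR, hy0R', fR, castVec_apply, Pi.sub_apply]
  have hval : T1 + T2 + T3 + T4 + T5 = ((sgnQ s : ℚ) : ℝ) * (if w then η l else a l) := by
    rw [← target_value s w l a η]
    have r1 : T1 = ∑ l' : Fin 3, (∑ i, ∑ j, (C.lamJ s w l i j : ℝ) * crossProduct (C.qR j) (fR i) l') * a l' := by
      rw [hT1]
      have : ∀ i, ∑ j, (C.lamJ s w l i j : ℝ) * (a ⬝ᵥ crossProduct (C.qR j) (fR i)) =
          ∑ l' : Fin 3, (∑ j, (C.lamJ s w l i j : ℝ) * crossProduct (C.qR j) (fR i) l') * a l' :=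
        fun i => sum_mul_dot _ _ _ _
      simp only [this]
      rw [Finset.sum_comm]
      exact Finset.sum_congr rfl fun l' _ => by rw [Finset.sum_mul]
    have r2 : T2 = ∑ l' : Fin 3, (∑ j, ∑ m, (C.lamC s w l j m : ℝ) * crossProduct (C.qR j) (Pi.single m (1:ℝ)) l') * a l' := by
      rw [hT2]
      have : ∀ j, ∑ m, (C.lamC s w l j m : ℝ) * (a ⬝ᵥ crossProduct (C.qR j) (Pi.single m 1)) =
          ∑ l' : Fin 3, (∑ m, (C.lamC s w l j m : ℝ) * crossProduct (C.qR j) (Pi.single m (1:ℝ)) l') * a l' :=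
        fun j => sum_mul_dot _ _ _ _
      simp only [this]
      rw [Finset.sum_comm]
      exact Finset.sum_congr rfl fun l' _ => by rw [Finset.sum_mul]
    have r3 : T3 = (∑ l' : Fin 3, (∑ j, (C.lamM s w l j : ℝ) * (C.qR j - C.y0R) l') * η l') +
        ∑ l' : Fin 3, (∑ j, (C.lamM s w l j : ℝ) * crossProduct (C.qR j) C.y0R l') * a l' := by
      rw [hT3, ← sum_mul_dot' _ _ _ η, ← sum_mul_dot _ _ _ a, ← Finset.sum_add_distrib]
      exact Finset.sum_congr rfl fun j _ => by ring
    have r4 : T4 = ∑ l' : Fin 3, (∑ i, (C.lamF s w l i : ℝ) * (fR i - C.y0R) l') * η l' := by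
      rw [hT4, sum_mul_dot']
    have r5 : T5 = ∑ l' : Fin 3, (((C.lamSp s w l : ℝ) - C.lamSm s w l) * C.y0R l') * η l' := by
      rw [hT5]; simp only [dotProduct, Fin.sum_univ_three]; ring
    rw [r1, r2, r3, r4, r5]
    simp only [eA, eE, Fin.sum_univ_three]
    ring
  -- (b) form by form they are bounded by K·U
  have hbd : T1 + T2 + T3 + T4 + T5 ≤ (C.K s w l : ℝ) * U := by
    have s1 : T1 ≤ ∑ i, ∑ j, (C.lamJ s w l i j : ℝ) * ((C.cJ i j : ℝ) * U) := by
      refine Finset.sum_le_sum fun i _ => Finset.sum_le_sum fun j _ => ?_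
      by_cases h0 : C.lamJ s w l i j = 0
      · simp [h0]
      · have hb := C.boundJ κ horth hJ hQ8 hFb hclus h0
        have hc0 : (0 : ℝ) ≤ (C.cJ i j : ℝ) := by
          have e : (C.cJ i j : ℝ) = (fR i ⬝ᵥ fR i + C.qR j ⬝ᵥ C.qR j) / 4 := by
            simp only [DTCert.cJ]; push_cast; rw [cast_dotQ, cast_dotQ]; rfl
          rw [e]; have := (by rw [dot_self_eq_sum_sq]; exact Finset.sum_nonneg fun _ _ => sq_nonneg _ : (0:ℝ) ≤ (fR i) ⬝ᵥ (fR i)); have := (by rw [dot_self_eq_sum_sq]; exact Finset.sum_nonneg fun _ _ => sq_nonneg _ : (0:ℝ) ≤ (C.qR j) ⬝ᵥ (C.qR j)); linarith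
        have hb' : a ⬝ᵥ crossProduct (C.qR j) (fR i) ≤ (C.cJ i j : ℝ) * U :=
          hb.trans (mul_le_mul_of_nonneg_left hFbU hc0)
        exact mul_le_mul_of_nonneg_left hb' (by exact_mod_cast (hJ s w l i j h0).1.le)
    have s2 : T2 = 0 := by
      refine Finset.sum_eq_zero fun j _ => Finset.sum_eq_zero fun m _ => ?_
      by_cases h0 : C.lamC s w l j m = 0
      · simp [h0]
      · rw [C.boundC κ horth hCo hQ8 hFb hclus h0, mul_zero]
    have s3 : T3 ≤ ∑ j, (C.lamM s w l j : ℝ) * ((C.cM j : ℝ) * U) := by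
      refine Finset.sum_le_sum fun j _ => ?_
      by_cases h0 : C.lamM s w l j = 0
      · simp [h0]
      · have hb := C.boundM κ y horth hM hy0 hcM h0
        have huse := (hM s w l j h0).2.1
        have hEη : E = η ⬝ᵥ η := by rw [hE, if_pos huse]
        have hb' : (C.qR j - C.y0R) ⬝ᵥ η + a ⬝ᵥ crossProduct (C.qR j) C.y0R ≤ (C.cM j : ℝ) * U := by
          rw [hU, hEη, hFb', hη]; simpa only [ha] using hb
        exact mul_le_mul_of_nonneg_left hb' (by exact_mod_cast (hM s w l j h0).1.le)
    have s4 : T4 ≤ ∑ i, (C.lamF s w l i : ℝ) * ((1 / 2 : ℝ) * U) := by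
      refine Finset.sum_le_sum fun i _ => ?_
      by_cases h0 : C.lamF s w l i = 0
      · simp [h0]
      · have hb := C.boundF y hF hcF h0
        have huse := (hF s w l i h0).2.1
        have hEη : E = η ⬝ᵥ η := by rw [hE, if_pos huse]
        have hb2 : (fR i - C.y0R) ⬝ᵥ η ≤ η ⬝ᵥ η / 2 := by rw [hη]; exact hb
        have hb' : (fR i - C.y0R) ⬝ᵥ η ≤ (1 / 2 : ℝ) * U := by linarith [hb2, hEU, hEη]
        exact mul_le_mul_of_nonneg_left hb' (by exact_mod_cast (hF s w l i h0).1.le)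
    have s5 : T5 ≤ (C.lamSm s w l : ℝ) * ((1 / 2 : ℝ) * U) := by
      obtain ⟨hp, hm, -⟩ := hS s w l
      have hp' : (0 : ℝ) ≤ C.lamSp s w l := by exact_mod_cast hp
      have hm' : (0 : ℝ) ≤ C.lamSm s w l := by exact_mod_cast hm
      by_cases h0 : C.lamSp s w l = 0 ∧ C.lamSm s w l = 0
      · rw [hT5]; simp only [h0.1, h0.2]; push_cast; simp
      · have hne : C.lamSp s w l ≠ 0 ∨ C.lamSm s w l ≠ 0 := by tauto
        have hsph := C.boundS y hS hy0 hy hne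
        have huse := (hS s w l).2.2 hne
        have hEη : E = η ⬝ᵥ η := by rw [hE, if_pos huse]
        have hsph' : C.y0R ⬝ᵥ η = -E / 2 := by rw [hEη, hη]; exact hsph
        rw [hT5, hsph']
        nlinarith [hE0, hEU]
    have hKe : (C.K s w l : ℝ) * U = (∑ i, ∑ j, (C.lamJ s w l i j : ℝ) * ((C.cJ i j : ℝ) * U)) +
        (∑ i, (C.lamF s w l i : ℝ) * ((1 / 2 : ℝ) * U)) + (∑ j, (C.lamM s w l j : ℝ) * ((C.cM j : ℝ) * U)) +
        (C.lamSm s w l : ℝ) * ((1 / 2 : ℝ) * U) := by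
      simp only [K]; push_cast
      simp only [Finset.sum_mul, add_mul]
      have e1 : ∀ i j, (C.lamJ s w l i j : ℝ) * (C.cJ i j : ℝ) * U = (C.lamJ s w l i j : ℝ) * ((C.cJ i j : ℝ) * U) :=
        fun i j => by ring
      have e2 : ∀ i, (C.lamF s w l i : ℝ) * (1 / 2) * U = (C.lamF s w l i : ℝ) * ((1 / 2 : ℝ) * U) :=
        fun i => by ring
      have e3 : ∀ j, (C.lamM s w l j : ℝ) * (C.cM j : ℝ) * U = (C.lamM s w l j : ℝ) * ((C.cM j : ℝ) * U) :=
        fun j => by ring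
      simp only [e1, e2, e3]
      ring
    rw [hKe]
    linarith [s1, s2, s3, s4, s5]
  have := le_trans (le_of_eq hval.symm) hbd
  simpa only [hU, hE, hη] using this

/-- **Soundness of a local rigidity certificate.**  See the module docstring. -/
theorem sound (hC : C.valid) (κ : Matrix (Fin 3) (Fin 3) ℝ)
    (horth : ∀ i j, κ i j + κ j i + ∑ l, κ l i * κ l j = 0) (y : Fin 3 → ℝ)
    (hclus : ∀ i j, fR i = C.qR j + κ *ᵥ C.qR j ∨
      2 ≤ (fR i - (C.qR j + κ *ᵥ C.qR j)) ⬝ᵥ (fR i - (C.qR j + κ *ᵥ C.qR j)))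
    (hy : C.useY = true → y ⬝ᵥ y = 2)
    (hcF : C.useY = true → ∀ i, clusterQ i ≠ 0 → 2 ≤ (y - fR i) ⬝ᵥ (y - fR i))
    (hcM : C.useY = true → ∀ j, C.Q j ≠ 0 → 2 ≤ (y - (C.qR j + κ *ᵥ C.qR j)) ⬝ᵥ (y - (C.qR j + κ *ᵥ C.qR j)))
    (hsmall : frob κ + (if C.useY then (y - C.y0R) ⬝ᵥ (y - C.y0R) else 0) < 1 / C.Ktot) :
    κ = 0 := by
  have hC' := hC
  obtain ⟨⟨hQ8, hy0, hK4, hKtot⟩, hJ, hCo, hF, hM, hS, hId, -⟩ := hC'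
  set a := axisOf κ with ha
  set Fb := frob κ with hFb
  set η : Fin 3 → ℝ := y - C.y0R with hη
  set E : ℝ := if C.useY then η ⬝ᵥ η else 0 with hE
  set U : ℝ := Fb + E with hU
  have hFb0 : 0 ≤ Fb := frob_nonneg κ
  have hE0 : 0 ≤ E := by rw [hE]; split_ifs; exacts [(by rw [dot_self_eq_sum_sq]; exact Finset.sum_nonneg fun _ _ => sq_nonneg _ : (0:ℝ) ≤ η ⬝ᵥ η), le_rfl]
  have hU0 : 0 ≤ U := add_nonneg hFb0 hE0
  have hKtot0 : (0 : ℝ) < C.Ktot := by exact_mod_cast (lt_of_lt_of_le (by norm_num) hK4)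
  have hUlt : U < 1 / (C.Ktot : ℝ) := hsmall
  have hK4R : (4 : ℝ) ≤ C.Ktot := by exact_mod_cast hK4
  have hU14 : U < 1 / 4 := lt_of_lt_of_le hUlt (by rw [one_div_le_one_div hKtot0 (by norm_num)]; exact hK4R)
  have hFb14 : Fb < 1 / 4 := by linarith
  -- coordinates
  have tgt := C.target_le hC κ horth y hclus hy hcF hcM hFb14
  have absA : ∀ l : Fin 3, a l ^ 2 ≤ (C.Kmax false l : ℝ) ^ 2 * U ^ 2 := by
    intro l
    have t1 := tgt false false l (Or.inl rfl)
    have t2 := tgt true false l (Or.inl rfl)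
    simp only [sgnQ, if_false, if_true, Bool.false_eq_true] at t1 t2
    push_cast at t1 t2
    have m1 : (C.K false false l : ℝ) ≤ (C.Kmax false l : ℝ) := by exact_mod_cast le_max_left _ _
    have m2 : (C.K true false l : ℝ) ≤ (C.Kmax false l : ℝ) := by exact_mod_cast le_max_right _ _
    refine sq_le_of_abs_le (le_trans ?_ (mul_le_mul_of_nonneg_right m1 hU0))
      (le_trans ?_ (mul_le_mul_of_nonneg_right m2 hU0))
    · simpa [hU, hE, hη] using t1
    · have := t2; simp only [neg_mul, one_mul] at this; simpa [hU, hE, hη] using this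
  have absE : C.useY = true → ∀ l : Fin 3, η l ^ 2 ≤ (C.Kmax true l : ℝ) ^ 2 * U ^ 2 := by
    intro huse l
    have t1 := tgt false true l (Or.inr huse)
    have t2 := tgt true true l (Or.inr huse)
    simp only [sgnQ, if_false, if_true, Bool.false_eq_true] at t1 t2
    push_cast at t1 t2
    have m1 : (C.K false true l : ℝ) ≤ (C.Kmax true l : ℝ) := by exact_mod_cast le_max_left _ _
    have m2 : (C.K true true l : ℝ) ≤ (C.Kmax true l : ℝ) := by exact_mod_cast le_max_right _ _
    refine sq_le_of_abs_le (le_trans ?_ (mul_le_mul_of_nonneg_right m1 hU0))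
      (le_trans ?_ (mul_le_mul_of_nonneg_right m2 hU0))
    · simpa [hU, hE, hη] using t1
    · have := t2; simp only [neg_mul, one_mul] at this; simpa [hU, hE, hη] using this
  -- the squeeze
  have hFb1 : Fb ≤ 1 := by linarith
  have hFa : Fb ≤ 8 / 3 * (a ⬝ᵥ a) := frob_le_axis_sq κ horth hFb1
  have haa : a ⬝ᵥ a = a 0 ^ 2 + a 1 ^ 2 + a 2 ^ 2 := by
    rw [dot_self_eq_sum_sq]; simp [Fin.sum_univ_three]
  have hηη : η ⬝ᵥ η = η 0 ^ 2 + η 1 ^ 2 + η 2 ^ 2 := by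
    rw [dot_self_eq_sum_sq]; simp [Fin.sum_univ_three]
  have hA0 := absA 0; have hA1 := absA 1; have hA2 := absA 2
  have hU2 : 0 ≤ U ^ 2 := sq_nonneg U
  have hsumA : Fb ≤ 8 / 3 * ((C.Kmax false 0 : ℝ) ^ 2 + (C.Kmax false 1 : ℝ) ^ 2 + (C.Kmax false 2 : ℝ) ^ 2) * U ^ 2 := by
    nlinarith [hFa, haa, hA0, hA1, hA2]
  have hUle : U ≤ (C.Ktot : ℝ) * U ^ 2 := by
    by_cases huse : C.useY = true
    · have hE0' := absE huse 0; have hE1 := absE huse 1; have hE2 := absE huse 2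
      have hEη : E = η ⬝ᵥ η := by rw [hE, if_pos huse]
      have hsumE : E ≤ ((C.Kmax true 0 : ℝ) ^ 2 + (C.Kmax true 1 : ℝ) ^ 2 + (C.Kmax true 2 : ℝ) ^ 2) * U ^ 2 := by
        rw [hEη, hηη]; linarith
      have hKtotR : (8 / 3 : ℝ) * ((C.Kmax false 0 : ℝ) ^ 2 + (C.Kmax false 1 : ℝ) ^ 2 + (C.Kmax false 2 : ℝ) ^ 2) +
          ((C.Kmax true 0 : ℝ) ^ 2 + (C.Kmax true 1 : ℝ) ^ 2 + (C.Kmax true 2 : ℝ) ^ 2) ≤ (C.Ktot : ℝ) := by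
        rw [if_pos huse] at hKtot
        have h' := (Rat.cast_le (K := ℝ)).2 hKtot
        push_cast at h'; exact h'
      have := mul_le_mul_of_nonneg_right hKtotR hU2
      linarith
    · have hE0' : E = 0 := by rw [hE, if_neg huse]
      have hKtotR : (8 / 3 : ℝ) * ((C.Kmax false 0 : ℝ) ^ 2 + (C.Kmax false 1 : ℝ) ^ 2 + (C.Kmax false 2 : ℝ) ^ 2) ≤
          (C.Ktot : ℝ) := by
        rw [if_neg huse, add_zero] at hKtot
        have h' := (Rat.cast_le (K := ℝ)).2 hKtot
        push_cast at h'; exact h'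
      have := mul_le_mul_of_nonneg_right hKtotR hU2
      linarith
  have hUz : U = 0 := eq_zero_of_le_mul_sq hKtot0 hU0 hUle hUlt
  have hFz : Fb = 0 := by linarith
  exact eq_zero_of_frob_eq_zero κ hFz

end DTCert

end Summit.Ventures.Crystal3D.Theorems.NearIdentity

end
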